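import Summits.BirchSwinnertonDyer.BirchSwinnertonDyer.Theorems.CyclotomicUntwistSigmaLineFamilyFormal
import Literature.NumberTheory.EllipticCurves.PadicSigmaVariableChangeProofs
import HarnessLib

/-!
# The σ-line family under an admissible change of variables `(u, r, s, t)` — formal transport
# (route `CyclotomicUntwist`, crux K1 `PSRankOneLowerHalfAtThree`; MODEL COVARIANCE, part 1)

Cell `pub/bsd-wall` (D-0145 line `route-BirchSwinnertonDyer-CyclotomicUntwist`), width seat
`bsd-line-cycu-p5` (gen 8). THEOREMS ONLY (no definition, no named fact, no `sorry`); helper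
`--supports` K1 = stmt-BirchSwinnertonDyer-21580 (serves K2 = 21581 equally). BSD is not proved by this
file and no crux of the route is.

WHY (pen ruling 2026-08-28T09:22:02Z, (K1′)/(K2′)): the K-SEP texts of record N-GZ₃′ / pBSD₃′
(`CyclotomicUntwistFiniteSlopeSeparatedPinnedLogNorm`) consume `‖ι h_ψ(P,P)‖` for the σ-LINE height
`h_χ(P,P) = h_{σ_{c₀}}(P) + (a + b·χ(2) − c₀)·log_W(z(P))²` built on the one-parameter formal sigma family
`formalSigma (W ⊗ ℚ₃) c` (`PerrinRiouCMSigma`) of a globally minimal `W`, and they quantify over ALL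
globally minimal `W`; the pen asked that the model dependence «(r,s,t,u) action on (ω, η): c shifts by r»
be recorded or the consumed quantity be proved invariant. This file is the FORMAL half: how the whole
family `c ↦ σ_c` moves along the isomorphism of formal groups `θ = formalVariableChange V vc`
(`z' = θ(z) = u z + ⋯`, tree `FormalGroupVariableChangeProofs`) induced by `vc = (u, r, s, t)`,
`x = u²x' + r`:

* §1 `inv_u_mul_formalSigma_smul_subst` / **`formalSigma_smul_subst`** — for EVERY constant `c'`,
  `σ^{vc • V}_{c'} ∘ θ = u · σ^{V}_{u²c' − r}`: the family of `vc • V` pulled back along `θ` IS the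
  family of `V`, re-indexed by the affine law **`c = u²c' − r`** (weight 2, shift by `−r`) and rescaled by
  the weight-one factor `u` of `σ` in `ω` (`ω_V = u⁻¹ω_{vc • V}`). Proof: the tree transports oddness and
  the sigma equation (`IsFormallyOdd.variableChange_subst`, `SatisfiesSigmaODE.variableChange_subst`,
  Mazur–Tate 1991 §3 / Mazur–Stein–Tate 2006 Thm 1.3 as landed in `PadicSigmaVariableChangeProofs`) and
  `formalSigma` is THE normalised odd solution (`eq_formalSigma`). This is the Mazur–Tate-PAIR-FREE twin
  of `padicSigma_eq_of_variableChange` (`CountingDoorF2AtThreeSchneiderOnDoorSubfamilyTransportSigma`,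
  which needs an MT pair of `vc • V` — none exists at an additive prime) and the general-`vc` form of
  cycu-p1's dilations `formalSigma_of_scaling` (`u = p²`) / `formalSigma_of_scaling_prime` (`u = p`).
* §1 `formalSigma_eq_inv_u_mul_smul_subst` — the same read from `V`: `σ^V_c = u⁻¹·σ^{vc•V}_{(c+r)/u²} ∘ θ`;
  `const_eq_of_formalSigma_smul_subst` — the index is forced: if `σ^{vc•V}_{c'} ∘ θ = u·σ^V_c` then
  `c = u²c' − r` (`formalSigma_injective`).
* §2 `C_mul_formalLog_sq_smul_subst`, `exp_formalLog_sq_smul_subst` — the correction series of the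
  σ-line height: `(ε·log'²) ∘ θ = (ε u²)·log²` and `exp(ε·log'²) ∘ θ = exp(εu²·log²)`
  (tree `formalLog_variableChange_subst`: `log' ∘ θ = u·log`).
* §3 `formalSigma_smul_subst_of_u_sq_eq_one` etc. — the case of two globally minimal models over `ℚ`
  (`u = ±1`, so `u² = 1`): **`σ'_{c'} ∘ θ = u·σ_{c' − r}`**, `log' ∘ θ = u·log`, `(ε log'²) ∘ θ = ε log²` —
  «c shifts by r», everything else is invariant up to the sign `u`, which `log_p` kills at the level of
  heights (part 3, `…SigmaLineFamilyModelCovariance`).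

References: B. Mazur, J. Tate, *The p-adic sigma function*, Duke Math. J. 62 (1991) §3, Thm. 3.1
(`σ_{(E,λω)} = λσ_{(E,ω)}`) [MazurTate1991]; B. Mazur, W. Stein, J. Tate, Doc. Math. Extra Vol. (2006)
Thm. 1.3, §1 (`c` has weight 2) [MazurSteinTate2006]; J. H. Silverman, *AEC* III.1 Table 3.1
(`u⁻¹ω' = ω`, `x = u²x' + r`) [SilvermanAEC2009].
-/

set_option autoImplicit false
-- single-conjunct summit: `Summit.BirchSwinnertonDyer.BirchSwinnertonDyer.…` repeats the name by design
set_option linter.dupNamespace false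

noncomputable section

open scoped Classical

open PowerSeries WeierstrassCurve Literature.NumberTheory.EllipticCurves
  Summit.BirchSwinnertonDyer.BirchSwinnertonDyer.Theorems.PSSigmaLineFamily

namespace Summit.BirchSwinnertonDyer.BirchSwinnertonDyer.Theorems.PSSigmaLineFamilyTransport

variable {p : ℕ} [Fact p.Prime] (V : WeierstrassCurve ℚ_[p]) (vc : VariableChange ℚ_[p])

/-! ### §1 The family transports: `σ^{vc • V}_{c'} ∘ θ = u · σ^V_{u²c' − r}` -/

/-- **Transport of the σ-family (normalised form).** For every constant `c'`,
`u⁻¹ · (σ^{vc • V}_{c'} ∘ θ) = σ^{V}_{u²c' − r}`: the pulled-back, renormalised series is normalised, odd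
for `V` and solves the sigma equation of `V` with constant `u²c' − r` (tree transport lemmas), hence is
THE member `formalSigma V (u²c' − r)` (`eq_formalSigma`). No integrality, no reduction hypothesis, every
prime. [Mazur–Tate 1991, §3; Mazur–Stein–Tate 2006, Thm. 1.3, §1] [cite: MazurSteinTate2006, Thm. 1.3]
[cite: MazurTate1991, Thm. 3.1] -/
theorem inv_u_mul_formalSigma_smul_subst (c' : ℚ_[p]) :
    C ((vc.u⁻¹ : ℚ_[p]ˣ) : ℚ_[p]) * ((vc • V).formalSigma c').subst (V.formalVariableChange vc) =
      V.formalSigma ((vc.u : ℚ_[p]) ^ 2 * c' - vc.r) := by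
  have h0 := constantCoeff_formalSigma (vc • V) c'
  have h1 := coeff_one_formalSigma (vc • V) c'
  refine eq_formalSigma ?_ ?_ ?_ ?_
  · rw [map_mul, V.constantCoeff_subst_formalVariableChange vc h0, mul_zero]
  · rw [coeff_C_mul, V.coeff_one_subst_formalVariableChange vc h1, Units.inv_mul]
  · exact (isFormallyOdd_formalSigma (vc • V) c').variableChange_subst _
  · exact (satisfiesSigmaODE_formalSigma (vc • V) c').variableChange_subst h0 h1

/-- **Transport of the σ-family: `σ^{vc • V}_{c'} ∘ θ = u · σ^{V}_{u²c' − r}`** for every `c'`.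
[Mazur–Tate 1991, §3, Thm. 3.1; Mazur–Stein–Tate 2006, Thm. 1.3] [cite: MazurSteinTate2006, Thm. 1.3]
[cite: MazurTate1991, Thm. 3.1] -/
theorem formalSigma_smul_subst (c' : ℚ_[p]) :
    ((vc • V).formalSigma c').subst (V.formalVariableChange vc) =
      C (vc.u : ℚ_[p]) * V.formalSigma ((vc.u : ℚ_[p]) ^ 2 * c' - vc.r) := by
  rw [← inv_u_mul_formalSigma_smul_subst V vc c', ← mul_assoc, ← map_mul, Units.mul_inv, map_one,
    one_mul]

/-- The index law solved for the constant of `vc • V`: `u²·(u⁻²(c + r)) − r = c`. [folklore] -/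
theorem u_sq_mul_inv_u_sq_mul_add_sub (c : ℚ_[p]) :
    (vc.u : ℚ_[p]) ^ 2 * (((vc.u⁻¹ : ℚ_[p]ˣ) : ℚ_[p]) ^ 2 * (c + vc.r)) - vc.r = c := by
  rw [← mul_assoc, ← mul_pow, Units.mul_inv, one_pow, one_mul, add_sub_cancel_right]

/-- **The family of `V` read through `vc • V`: `σ^V_c = u⁻¹ · σ^{vc • V}_{(c + r)/u²} ∘ θ`** for every `c`.
[Mazur–Tate 1991, §3; Mazur–Stein–Tate 2006, Thm. 1.3, §1] [cite: MazurSteinTate2006, Thm. 1.3] -/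
theorem formalSigma_eq_inv_u_mul_smul_subst (c : ℚ_[p]) :
    V.formalSigma c = C ((vc.u⁻¹ : ℚ_[p]ˣ) : ℚ_[p]) *
      ((vc • V).formalSigma (((vc.u⁻¹ : ℚ_[p]ˣ) : ℚ_[p]) ^ 2 * (c + vc.r))).subst
        (V.formalVariableChange vc) := by
  rw [inv_u_mul_formalSigma_smul_subst, u_sq_mul_inv_u_sq_mul_add_sub]

/-- **The index is forced.** If the member `σ^{vc • V}_{c'}` pulls back to `u·σ^V_c`, then `c = u²c' − r`
(the family is injective in its constant, `formalSigma_injective`): the σ-constant of a model has weight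
`2` and SHIFTS BY `−r` under `x = u²x' + r` — the «c shifts by r» of the pen's ruling.
[Mazur–Stein–Tate 2006, §1 (weight of `c`)] [cite: MazurSteinTate2006, Thm. 1.3] -/
theorem const_eq_of_formalSigma_smul_subst {c c' : ℚ_[p]}
    (h : ((vc • V).formalSigma c').subst (V.formalVariableChange vc) = C (vc.u : ℚ_[p]) * V.formalSigma c) :
    c = (vc.u : ℚ_[p]) ^ 2 * c' - vc.r := by
  have h' := formalSigma_smul_subst V vc c'
  rw [h] at h'
  have hu : IsUnit (C (vc.u : ℚ_[p]) : ℚ_[p]⟦X⟧) := (Units.isUnit vc.u).map C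
  exact formalSigma_injective V (hu.mul_left_cancel h')

/-- Conversely, members with matching indices DO correspond: `σ^{vc•V}_{c'} ∘ θ = u·σ^V_c ↔ c = u²c' − r`.
[cite: MazurSteinTate2006, Thm. 1.3] -/
theorem formalSigma_smul_subst_eq_iff (c c' : ℚ_[p]) :
    ((vc • V).formalSigma c').subst (V.formalVariableChange vc) = C (vc.u : ℚ_[p]) * V.formalSigma c ↔
      c = (vc.u : ℚ_[p]) ^ 2 * c' - vc.r := by
  refine ⟨const_eq_of_formalSigma_smul_subst V vc, fun h => ?_⟩
  rw [h, formalSigma_smul_subst]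

/-! ### §2 The correction series `exp(ε·log²)` of the σ-line height under `θ` -/

/-- `(ε·log'²) ∘ θ = (ε·u²)·log²` (`log' ∘ θ = u·log`, tree `formalLog_variableChange_subst`).
[Silverman AEC IV.5; III.1 Table 3.1] [cite: SilvermanAEC2009, IV.5.5] -/
theorem C_mul_formalLog_sq_smul_subst (ε : ℚ_[p]) :
    (C ε * (vc • V).formalLog ^ 2).subst (V.formalVariableChange vc) =
      C (ε * (vc.u : ℚ_[p]) ^ 2) * V.formalLog ^ 2 := by
  have hθs := V.hasSubst_formalVariableChange vc
  have hC : (C ε : ℚ_[p]⟦X⟧).subst (V.formalVariableChange vc) = C ε := PowerSeries.subst_C ε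
  rw [subst_mul hθs, subst_pow hθs, hC, V.formalLog_variableChange_subst vc, mul_pow, ← map_pow, map_mul]
  ring

/-- `exp(ε·log'²) ∘ θ = exp(εu²·log²)`: the one-parameter group that moves along the family
(`σ_{c'} = σ_c·exp(((c − c')/2)·log²)`, cycu-p1 `formalSigma_eq_formalSigma_mul_exp`) transports to the
corresponding one-parameter group of `V`. [cite: MazurSteinTate2006, Thm. 1.3] -/
theorem exp_formalLog_sq_smul_subst (ε : ℚ_[p]) :
    PowerSeries.subst (V.formalVariableChange vc) ((exp ℚ_[p]).subst (C ε * (vc • V).formalLog ^ 2)) =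
      (exp ℚ_[p]).subst (C (ε * (vc.u : ℚ_[p]) ^ 2) * V.formalLog ^ 2) := by
  have hθs := V.hasSubst_formalVariableChange vc
  have hg : HasSubst (C ε * (vc • V).formalLog ^ 2) :=
    HasSubst.of_constantCoeff_zero' (constantCoeff_C_mul_formalLog_sq (vc • V) ε)
  have h1 := C_mul_formalLog_sq_smul_subst V vc ε
  rw [subst_comp_subst_apply hg hθs]
  exact congrArg (fun a : ℚ_[p]⟦X⟧ => (exp ℚ_[p]).subst a) h1

/-- Consistency of §1 with the one-parameter group: transporting `σ_{c'} = σ_{c''}·exp(((c''−c')/2)·log'²)`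
along `θ` gives `u·σ_{u²c'−r} = u·σ_{u²c''−r}·exp((u²(c''−c')/2)·log²)`, which is cycu-p1's shift law on `V`
between the transported indices (their difference is `u²(c'' − c')`). [cite: MazurSteinTate2006, Thm. 1.3] -/
theorem formalSigma_smul_subst_mul_exp (c' c'' : ℚ_[p]) :
    ((vc • V).formalSigma c').subst (V.formalVariableChange vc) =
      ((vc • V).formalSigma c'').subst (V.formalVariableChange vc) *
        (exp ℚ_[p]).subst (C ((c'' - c') / 2 * (vc.u : ℚ_[p]) ^ 2) * V.formalLog ^ 2) := by
  have hθs := V.hasSubst_formalVariableChange vc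
  conv_lhs => rw [formalSigma_eq_formalSigma_mul_exp (vc • V) c'' c', subst_mul hθs,
    exp_formalLog_sq_smul_subst]

/-! ### §3 Two globally minimal models: `u² = 1` — «`c` shifts by `r`» -/

/-- For `u² = 1` (the case `u = ±1` of two globally minimal models over `ℚ`, AEC VII.1.3(b)):
**`σ^{vc•V}_{c'} ∘ θ = u·σ^V_{c' − r}`**. [Mazur–Stein–Tate 2006, §1; Silverman AEC VII.1.3(b)]
[cite: MazurSteinTate2006, Thm. 1.3] [cite: SilvermanAEC2009, VII.1.3(b) and VIII.8.3] -/
theorem formalSigma_smul_subst_of_u_sq_eq_one (hu : (vc.u : ℚ_[p]) ^ 2 = 1) (c' : ℚ_[p]) :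
    ((vc • V).formalSigma c').subst (V.formalVariableChange vc) =
      C (vc.u : ℚ_[p]) * V.formalSigma (c' - vc.r) := by
  rw [formalSigma_smul_subst, hu, one_mul]

/-- For `u² = 1`: `σ^V_c = u·(σ^{vc•V}_{c + r} ∘ θ)` (`u⁻¹ = u`). [cite: MazurSteinTate2006, Thm. 1.3]
[cite: SilvermanAEC2009, VII.1.3(b) and VIII.8.3] -/
theorem formalSigma_eq_of_u_sq_eq_one (hu : (vc.u : ℚ_[p]) ^ 2 = 1) (c : ℚ_[p]) :
    V.formalSigma c =
      C (vc.u : ℚ_[p]) * ((vc • V).formalSigma (c + vc.r)).subst (V.formalVariableChange vc) := by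
  rw [formalSigma_smul_subst_of_u_sq_eq_one V vc hu, add_sub_cancel_right, ← mul_assoc, ← map_mul,
    ← sq, hu, map_one, one_mul]

/-- For `u² = 1`: `(ε·log'²) ∘ θ = ε·log²` — the `log²`-correction of the σ-line height is INVARIANT.
[cite: SilvermanAEC2009, IV.5.5] -/
theorem C_mul_formalLog_sq_smul_subst_of_u_sq_eq_one (hu : (vc.u : ℚ_[p]) ^ 2 = 1) (ε : ℚ_[p]) :
    (C ε * (vc • V).formalLog ^ 2).subst (V.formalVariableChange vc) = C ε * V.formalLog ^ 2 := by
  rw [C_mul_formalLog_sq_smul_subst, hu, mul_one]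

/-- For `u² = 1`: the index is forced to shift by `r` — `σ^{vc•V}_{c'} ∘ θ = u·σ^V_c ↔ c = c' − r`.
[cite: MazurSteinTate2006, Thm. 1.3] -/
theorem formalSigma_smul_subst_eq_iff_of_u_sq_eq_one (hu : (vc.u : ℚ_[p]) ^ 2 = 1) (c c' : ℚ_[p]) :
    ((vc • V).formalSigma c').subst (V.formalVariableChange vc) = C (vc.u : ℚ_[p]) * V.formalSigma c ↔
      c = c' - vc.r := by
  rw [formalSigma_smul_subst_eq_iff, hu, one_mul]

end Summit.BirchSwinnertonDyer.BirchSwinnertonDyer.Theorems.PSSigmaLineFamilyTransport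

end
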